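import Mathlib.Analysis.SpecificLimits.Normed
import Mathlib.Analysis.Asymptotics.Lemmas
import Literature.Computability.Complexity.MurrayWilliams2018EasyWitness
import Literature.Computability.Complexity.CircuitComposition
import HarnessLib

/-!
# Witness circuits: sanity theorems (proofs only)

Companion of `MurrayWilliams2018EasyWitness.lean` (Murray–Williams 2018, Lemma 4.1 as a named
fact, the notion of witness circuits) and of
`MurrayWilliams2018EasyWitnessProofs.lean` (which shows that the LITERAL all-lengths reading
`MurrayWilliams2018_lemma_4_1` has an unsatisfiable hypothesis and holds vacuously, the contentful
fact being the almost-everywhere form `MurrayWilliams2018_lemma_4_1_ae`). This file PROVES an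
elementary fact calibrating the conclusion predicate, showing it is inhabited in the intended
way, and two growth estimates of the kind fed to the nondeterministic time hierarchy theorem
(`Diag.ntime_hierarchy_holds`, `DiagMachine.lean`: `f(n+1) = o(g(n))`):

* `exists_circuit_truthTable_prefix` — every string `y` with `|y| ≤ 2^ℓ` is a prefix of the
  truth table (`MetaComplexity.truthTable`) of SOME `B₂`-circuit on `ℓ` inputs with at most
  `univBound ℓ` gates (the table-lookup function, realized by Shannon expansion,
  `cktSize_univ`; Arora–Barak 2009, Claim 2.13); hence
  **`NTIMEHasWitnessCircuits_univBound`**: for every time bound `t` with `n ≤ t n`, `NTIME t`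
  has (trivial, exponential-size) witness circuits of size `univBound ((t n)²)` — every witness
  is encoded by some circuit, so the content of the Easy Witness Lemma
  (`MurrayWilliams2018_lemma_4_1_ae`) is entirely in the SIZE `s₂(s₂(s₂(n)))^{2g}` of the
  encoding circuits;
* `isBigO_two_pow_succ`, `isLittleO_succ_pow_two_pow` — `2^{n+1} = O(2ⁿ)` and `(n+1)ᵏ = o(2ⁿ)`
  (real-valued casts, Mathlib's `IsBigO`/`IsLittleO` along `atTop`).

## References

* C. D. Murray, R. R. Williams, *Circuit lower bounds for nondeterministic quasi-polytime: an easy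
  witness lemma for NP and NQP*, STOC 2018, §2 (witness circuits) [MurrayWilliams2018].
* S. Arora, B. Barak, *Computational Complexity: A Modern Approach*, CUP 2009, Claim 2.13 (every
  function has a circuit), Thm. 3.2 (the growth condition `f(n+1) = o(g(n))`) [AroraBarak2009].
-/

namespace Literature.Computability.Complexity

open Filter Asymptotics

/-! ### Every string is a prefix of the truth table of some circuit -/

/-- **Table lookup as a circuit**: a string `y` with `|y| ≤ 2^ℓ` is a prefix of the truth table
of some `B₂`-circuit on `ℓ` inputs with at most `univBound ℓ` gates (the function
`v ↦ y[#v]`, `#v` the number of `v` in the enumeration `boolFunEquivFin`, padded by `false`;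
realized by `cktSize_univ`, Arora–Barak 2009, Claim 2.13). [cite: AroraBarak2009, Claim 2.13] -/
theorem exists_circuit_truthTable_prefix (y : List Bool) (ℓ : ℕ) (h : y.length ≤ 2 ^ ℓ) :
    ∃ W : Circuit (Fin ℓ), W.IsOver B2 ∧ W.size ≤ univBound ℓ ∧
      y <+: MetaComplexity.truthTable W.eval := by
  classical
  let f : (Fin ℓ → Bool) → Bool := fun v => y.getD (MetaComplexity.boolFunEquivFin ℓ v) false
  obtain ⟨W, hB, hs, hW⟩ := (cktSize_univ (ι := Fin ℓ) fun v (_ : Unit) => f v).toCircuit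
  refine ⟨W, hB, by simpa using hs, ?_⟩
  have hev : W.eval = f := funext fun v => hW v
  have htt : MetaComplexity.truthTable f = List.ofFn fun i : Fin (2 ^ ℓ) => y.getD i false := by
    simp [MetaComplexity.truthTable, f]
  rw [hev, htt, List.prefix_iff_eq_take]
  apply List.ext_getElem
  · simp [h]
  · intro i h1 h2
    have hi : i < y.length := by simpa using h1
    simp [List.getElem_take, List.getD_eq_getElem?_getD, List.getElem?_eq_getElem hi]

/-- **Trivial witness circuits** (sanity / non-vacuity of `NTIMEHasWitnessCircuits`): if
`n ≤ t n` for all `n`, then `NTIME t` has witness circuits of size `univBound ((t n)²)` — for a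
verifier with constant `c` and inputs of length `n ≥ 2c + 2`, a witness has length
`≤ c · t n + c ≤ (t n)² ≤ 2^{(t n)²}` and is a prefix of the truth table of a circuit on `(t n)²`
inputs (`exists_circuit_truthTable_prefix`). The Easy Witness Lemma is about replacing this
exponential bound by `s₂(s₂(s₂(n)))^{2g}`. [cite: MurrayWilliams2018, §2 (Witness Circuits)] -/
theorem NTIMEHasWitnessCircuits_univBound {t : ℕ → ℕ} (ht : ∀ n, n ≤ t n) :
    NTIMEHasWitnessCircuits t (fun n => univBound (t n ^ 2)) := by
  intro L _ V
  refine ⟨2 * V.c + 2, fun x hx hn => ?_⟩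
  obtain ⟨y, hy, hrel⟩ := (V.mem_iff x).1 hx
  have h0 : 2 * V.c + 2 ≤ t x.length := hn.trans (ht x.length)
  have h1 : V.c * t x.length + V.c ≤ t x.length ^ 2 := by
    have h3 : 2 * (V.c * t x.length) + 2 * t x.length ≤ t x.length ^ 2 := by nlinarith [h0]
    have h4 : V.c ≤ V.c * t x.length := Nat.le_mul_of_pos_right _ (by omega)
    omega
  have h2 : y.length ≤ 2 ^ (t x.length ^ 2) := (hy.trans h1).trans Nat.lt_two_pow_self.le
  obtain ⟨W, hB, hs, hpre⟩ := exists_circuit_truthTable_prefix y (t x.length ^ 2) h2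
  exact ⟨t x.length ^ 2, W, y, hB, hs, hy, hrel, hpre⟩

/-! ### Growth estimates: `2ⁿ` versus `nᵏ` -/

/-- `2^{n+1} = O(2ⁿ)` (real-valued casts of the natural numbers). [folklore] -/
theorem isBigO_two_pow_succ :
    (fun n : ℕ => ((2 ^ (n + 1) : ℕ) : ℝ)) =O[atTop] fun n : ℕ => ((2 ^ n : ℕ) : ℝ) := by
  refine IsBigO.of_bound 2 (Eventually.of_forall fun n => ?_)
  rw [Real.norm_natCast, Real.norm_natCast]
  exact_mod_cast (le_of_eq (by ring) : 2 ^ (n + 1) ≤ 2 * 2 ^ n)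

/-- `(n+1)ᵏ = o(2ⁿ)` (real-valued casts of the natural numbers). [folklore] -/
theorem isLittleO_succ_pow_two_pow (k : ℕ) :
    (fun n : ℕ => (((n + 1) ^ k : ℕ) : ℝ)) =o[atTop] fun n : ℕ => ((2 ^ n : ℕ) : ℝ) := by
  have h1 : (fun n : ℕ => (((n + 1) ^ k : ℕ) : ℝ)) =O[atTop] fun n : ℕ => ((n ^ k : ℕ) : ℝ) := by
    refine IsBigO.of_bound (2 ^ k) ?_
    filter_upwards [eventually_ge_atTop 1] with n hn
    rw [Real.norm_natCast, Real.norm_natCast]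
    have h : (n + 1) ^ k ≤ 2 ^ k * n ^ k := by
      rw [← mul_pow]; exact Nat.pow_le_pow_left (by omega) k
    exact_mod_cast h
  have h2 : (fun n : ℕ => ((n ^ k : ℕ) : ℝ)) =o[atTop] fun n : ℕ => ((2 ^ n : ℕ) : ℝ) := by
    have ht := tendsto_pow_const_div_const_pow_of_one_lt k (one_lt_two (α := ℝ))
    have h2' : (fun n : ℕ => (n : ℝ) ^ k) =o[atTop] fun n : ℕ => (2 : ℝ) ^ n :=
      isLittleO_of_tendsto (fun n h => absurd h (by positivity)) ht
    simpa using h2'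
  exact h1.trans_isLittleO h2

end Literature.Computability.Complexity
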